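import Mathlib
import Literature.MathematicalPhysics.QuantumFieldTheory.Balaban1983to89.B6Lemma21Bridge
import Literature.MathematicalPhysics.QuantumFieldTheory.Balaban1983to89.B6Decomp247LevelGap
import Literature.MathematicalPhysics.QuantumFieldTheory.Balaban1983to89.B6TowerDecomp

/-!
# `Balaban1983to89.B6Decomp247Lattice` — [Balaban1984PropagatorsII] Lemma 2.1: THE DECOMPOSITION DATA (2.47)/(2.48)/(2.57)
# OF `B6Lemma21Bridge` CONSTRUCTED FOR EVERY CONTOUR SYSTEM DRAWN ON A LATTICE, hence (2.61″) with the d-ONLY constant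
# c₁″ = 13c₀(½α)^{4d} and `Lemma21TwoScale` for every such geometry (the existence leaf of the bridge discharged at the
# generality of the tree's (2.46) dictionary; the towers re-derived as an instance)

statement-level skeleton of published theorems with citation tags; proofs where landed; nothing here is a claim about the Yang–Mills mass gap

CITATION HEADER (lean-in-tree rule 2026-08-18).  Source: T. Bałaban, *Propagators and renormalization transformations for
lattice gauge theories. II*, Commun. Math. Phys. **96**, 223–250 (1984), doi:10.1007/bf01240221 [Balaban1984PropagatorsII]
(cell paper B6; PDF held: `paper:balaban1984-cmp96-propagators-rt-ii`, journal page = PDF page + 222; pp. 231–234 [PDF 9–12]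
re-read this generation from the text layer, the displays from the sibling headers which quote them verbatim from the ×2
renders).  WHAT IS REPRODUCED: lit-balaban SKELETON rows **B6.Lem2.1** (Lemma 2.1 (2.60)–(2.63) p. 234), **B6.Eq2.56**
((2.57)–(2.58) p. 233), **B6.Eq2.47** ((2.47)–(2.48) pp. 231–232) — cells only, no head change (the printed c₁(α) and the
printed count (2.58) stay refuted as typed, GAPS G-A11-1 / G-B6-01a/b/c).  Unit `lit-balaban-p29` (Phase-2 proof seat p29,
gen 12), HOME `run/shared/lean/pub/lit-balaban/`; B6 fold owner r03, referee ref-4.  IMPORTS, NOT MODIFIED: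
`…B6Lemma21Bridge` (b06: `Step`/`pathC`/`pathF`/`pathV`, the hypothesis structure `Decomp247` and the bridge
`ineq261T_of_decomp` / `lemma21TwoScale_of_decomp` (2.47)+(2.48)+(2.57)+reconstruction ⇒ (2.61″)), `…B6Decomp247Surfaces`
and `…B6Decomp247LevelGap` (r03 g7: the printed decomposition (2.47) of EVERY admissible contour — `aIdx`/`bIdx`/`eIdx`/
`js`/`m`, `X_facts`, `S_zone`, `js_step`, `js_one_bounds`, `js_m_bounds` — and (2.57) in walk form,
`length_ge_mul_episodes`), `…B6TowerDecomp` (b06 g24: the same data built by an ad-hoc encoder on the (k+1)-level tower;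
here only its step lemmas `svec`/`pathV_cons`/… and `eq_of_pos_eq` are used).  Nothing is restated.

THE PRINTED TEXT (pp. 231–233; verbatim in the headers of `…B6Decomp247Surfaces` and `…B6Lemma21Bridge`).  p. 231:
*"For an arbitrary contour Γ on the lattice T_η we put |Γ| = nη, where n is a number of bonds the contour Γ consists of. …
a part of Γ contained in B^j(Λ_j) consists of bonds of the lattice Λ_j. Now we define d(y, y′) = inf … (2.46) … Of course
the infimum is attained at some contour Γ_{y,y′}"*, then the decomposition (2.47) (points y_l, y′_l ∈ Σ_{j_l}, the portions
Γ_{y,y₁}, Γ_{y_l,y′_l}, Γ_{y′_l,y_{l+1}} ⊂ B^{j_{l,l+1}}(Λ_{j_{l,l+1}}), |j_l − j_{l+1}| = 1); p. 232 (2.48); p. 233: *"(2.57) The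
distances on the right-hand side of (2.48) are scaled to unit lattice and we estimate e^{−αδ₀d(y,y′)} using (2.48) and adding
sums over all intermediate points y_l, y′_l, l = 1, …, m, and over all possible numbers m. We get … (2.58) where s(y)
denotes a scaled image of y on unit lattice"*.

THE POINT.  `B6Lemma21Bridge.ineq261T_of_decomp` derives (2.61″) `sup_y Σ_{y′} e^{−αδ₀d(y,y′)} ≤ c₁″ = 13c₀(½α)^{4d}` — a
constant depending on d, δ₀, α ONLY — from decomposition DATA `Decomp247 g d y` whose one non-bookkeeping field is the
RECONSTRUCTION `hinj`: a site y′ of given level is determined by m, the leg codes (= print's *"scaled images"*) and the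
branch signs of (j_l).  That structure was CONSTRUCTED so far only on the (k+1)-level tower (`B6TowerDecomp`, by a
tower-specific encoder/decoder and a face test); everywhere else it is a hypothesis (census H-B6.1, the `hdecomp` binder),
and off the towers the only kernel (2.61) has the L-DEPENDENT constant `B6Ineq261LevelGap.K261` (packing route; p29 g10,
p21's k-level box `B6Geom246MultiLevelBox.lemma21_box`).  r03's later `B6Decomp247Surfaces` proves the decomposition
(2.47) ITSELF for every admissible contour over the abstract dictionary.  THIS FILE joins the two: for every contour
system DRAWN ON A LATTICE — `LatticeDrawing`: injective positions in an abelian group with a lattice frame ℤᵈ →+ A (ℤᵈ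
itself for boxes and the universal cover, (ℤ/N)ᵈ for tori), every admissible bond an axis move of length
`bscale (min zone)` in the frame (the EXACT form of the dictionary's (len) rule `B6LevelGapMetric.BondScale`) — the
portions of r03's decomposition of a SHORTEST contour are CODED by their signed axis steps (§1: `toStep`, `steps`;
surface portions two-scale with the flag "Λ_{j_l−1}-bond", §2 `legSOf`), the codes DETERMINE the displacements (§1
`pos_sub_single`, `pos_sub_two`; §2 `pos_sub_first`/`pos_sub_surf`/`pos_sub_cross` = the three kinds of portions), and
hence THE RECONSTRUCTION holds (§2 `reconstruct`: induction along the episodes — equal code of Γ_{y,y₁} ⇒ equal y₁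
(injectivity) ⇒ equal j₁; equal two-scale code ⇒ equal y′_l; equal branch sign ⇒ equal j_{l+1}; equal crossing code ⇒
equal y_{l+1}; finally equal y′).  With `hwt` = the codes have |Γ| = d(y, y′) letters (`codes_length`, the portions tile
the contour) and `hsep` = RM(m − 1) ≤ d(y, y′) (r03's `length_ge_mul_episodes` + RM ≤ N) this gives §3 `decomp247`:
`Decomp247 g d y` FOR EVERY BASE POINT OF EVERY LATTICE-DRAWN, CONNECTED, SEPARATING, LevelGap-N REALISED GEOMETRY, and
therefore `ineq261T_of_latticeDrawing` ((2.61″) with c₁″), `sum_exp_le_of_latticeDrawing`,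
`lemma21TwoScale_of_latticeDrawing` (`B6Lemma21TwoScale.Lemma21TwoScale` for every family), `lemma21_full_of_latticeDrawing`
((2.60)–(2.63) with c₁″).  §4: the (k+1)-level tower of `B6LevelTower` IS a lattice drawing (`towerDrawing`, from
`B6LevelTower.pos_step` + `tower_pos_injective`), so `twGeo_ineq261T_of_latticeDrawing` re-derives the conclusion of
`B6TowerDecomp.twGeo_ineq261T` by the general route (and without its `1 ≤ a`), `lemma21TwoScale_towers_of_latticeDrawing`
likewise — the cross-check of the general construction against the tower's own decoder, and the non-vacuity of every
hypothesis (`B6TowerDecomp.towerDecomp_nonvacuous`: for all d, k, L ≥ 1, δ₀, α > 0 some tower meets RM ≤ a + 1 and (2.59)).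

WHAT IS PROVED (kernel-checked; no `sorry`; axioms ⊆ {propext, Classical.choice, Quot.sound}; ONE new `structure`
(`LatticeDrawing`, a hypothesis record with data) and its constructor `LatticeDrawing.ofAxis`; 0 new `def … : Prop` facts).
See the section headers §1–§4 and the docstrings; the main declarations are `LatticeDrawing.reconstruct`, `decomp247`,
`ineq261T_of_latticeDrawing`, `lemma21TwoScale_of_latticeDrawing`, `lemma21_full_of_latticeDrawing`, `towerDrawing`,
`twGeo_ineq261T_of_latticeDrawing`, `lemma21TwoScale_towers_of_latticeDrawing`.

TYPING ∕ DIVERGENCE (honest).  (a) THE DICTIONARY.  Everything is stated over the tree's typed reading of (2.46)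
(`B6Geometry` D-pv08g2.1: lattice points with zones, admissible bonds a graph, (2.46) = the least number of bonds,
`Separates`, the walk form `LevelGap` of (2.2)/(2.57)) with the (len) rule in EXACT form: an admissible bond with end-point
zones j, j′ is an axis move of length `bscale (min{j, j′})` (print: a Λ_j-bond has length L^jη; which lattice a bond ACROSS an
interface ∂B^j(Λ_j) belongs to is not specified in print — `B6Geom246MultiLevelBox` header — and the dictionary's min-zone
rule is the reading under which print's own statements *"|Γ| = nη"*, (2.48) and (2.57) hold as displayed; the other reading
in the tree, «the two blocks touch» (`B6Geom246MultiLevelBox.bond`, `B15TouchingCubeContours.touchC`), is NOT a lattice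
drawing and keeps the L-dependent `K261`: for it an L-free constant is impossible, a coarse block touching L^{d−1} fine
ones at distance 1).  (b) d-ONLY CONSTANT, PRINT'S TRADE: c₁″ = 13c₀(½α)^{4d} needs (2.59) `B6.Cond259` exactly as print's
c₁ does; it is the lineage's corrected constant (G-A13-1/G-A16-1: two-scale surface legs + branch bits), not the printed
12c₀(½α)^d (refuted as typed, `B6Lemma21Counterexample`, `B6Lemma21TwoDimRefutation`).  (c) The decomposition is r03's,
read with the crossing points `OnSurf` as surface points (its TYPING (a)); the portions are index intervals of the walk
(its TYPING (b)); episodes are indexed from 0 in the `Decomp247` fields (print's l = ours + 1); `[NeZero d]` (a junk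
letter past the end of a contour needs a direction; print has d ≥ 1).  (d) INSTANCES IN THE TREE: the (k+1)-level towers
(§4; k + 1 ≥ 3 levels, every L ≥ 1).  A lattice-drawn contour system on a GENERAL nested family of cube domains (the ℤᵈ
carrier of `B15Ineq147LevelGap`, p21's box `Domains`) is NOT constructed here — its missing piece is the existence of
admissible contours (connectedness) under the min-zone rule, not anything in this file; for those carriers the tree's
(2.61) remains the `K261` one of the touching reading.  (e) `Realizes`, `Connected`, `Separates`, `LevelGap N`, `RM ≤ N`
and the injectivity of ι : 𝔅 → lattice points are hypotheses of the dictionary, each a theorem on the towers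
(`B6LevelTower`).  HONEST SCOPE: finite combinatorics (coding and decoding lattice walks) closing a bookkeeping leaf of a
published proof as repaired in the tree; NOT the printed constant, NOT a construction of print's domains in a torus,
NOT anything analytic, NOT progress on any Clay problem.
-/

namespace Literature.MathematicalPhysics.QuantumFieldTheory.Balaban1983to89.B6Decomp247Lattice

open B6Geometry (Separates LevelGap ContourSystem Realizes dist246)
open B6Lemma21Bridge (Step pathC pathF pathV Decomp247)
open B6TowerDecomp (svec cvec_add_fvec cvec_of_fine_false fvec_of_fine_false cvec_of_fine_true fvec_of_fine_true
  pathV_cons pathC_cons pathF_cons pathC_nil pathF_nil pathV_nil)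

/-! ## §1 Lattice drawings of a zoned graph of admissible bonds; the step read off a bond -/

section Drawing

variable {V : Type*} {G : SimpleGraph V} {zone : V → ℕ} {d : ℕ} {A : Type*} [AddCommGroup A]

/-- **A LATTICE DRAWING of a zoned graph of admissible bonds** (the hypothesis structure of this file): every vertex has
a position `pos x` in an abelian group `A` carrying a LATTICE FRAME `frame : ℤᵈ →+ A` (print: the lattice point
x ∈ T_η; `A = ℤᵈ`, `frame = id` for boxes and the universal cover, `A = (ℤ/N)ᵈ` with the quotient frame for the torus
T_η), distinct vertices have distinct positions, and every admissible bond `{u, v}` displaces the position by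
`frame (± bscale (min (zone u) (zone v)) · e_μ)` for ONE axis `μ` (print p. 231: *"a part of Γ contained in B^j(Λ_j)
consists of bonds of the lattice Λ_j"* — a Λ_j-bond is an axis segment of length L^jη, so `bscale j = L^j`).  SATISFIED BY
the bond-lattice contour systems: the (k+1)-level tower `B6LevelTower.twCS` (`B6LevelTower.pos_step`, see
`LatticeDrawing.ofAxis` and `towerDrawing` below).  NOT SATISFIED BY the «touching blocks» realisations of (2.46) —
p21's box geometry `B6Geom246MultiLevelBox.geom D` / `bond D` and the cube-carrier graph `B15TouchingCubeContours.touchC`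
(there two blocks are joined whenever they touch, e.g. diagonally or a coarse block with each of the L^{d−1} fine blocks
on its face: not axis moves of one length per zone pair) — for those the tree's (2.61) stays the L-dependent
`B6Ineq261LevelGap.K261`. [cite: Balaban1984PropagatorsII, (2.46) p.231] -/
structure LatticeDrawing (G : SimpleGraph V) (zone : V → ℕ) (d : ℕ) (A : Type*) [AddCommGroup A] where
  /-- the position of a lattice point -/
  pos : V → A
  /-- the lattice frame: how a displacement of the unit lattice ℤᵈ acts on positions -/
  frame : (Fin d → ℤ) →+ A
  /-- the length of a Λ_q-bond, in units of η (print: L^q) -/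
  bscale : ℕ → ℤ
  /-- every admissible bond is an axis move of length `bscale (min zone)` in the frame -/
  step : ∀ ⦃u v : V⦄, G.Adj u v → ∃ μ : Fin d, ∃ s : ℤ, (s = 1 ∨ s = -1) ∧
    pos v - pos u = frame (Pi.single μ (s * bscale (min (zone u) (zone v))))
  /-- distinct lattice points have distinct positions -/
  inj : Function.Injective pos

namespace LatticeDrawing

/-- **The ℤᵈ case from the coordinate form** used by the tree's coordinatised models (`B6LevelTower.pos_step`): integer
positions, every admissible bond moves exactly one coordinate, by `bscale (min zone)` in absolute value.
[cite: Balaban1984PropagatorsII, (2.46) p.231] -/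
noncomputable def ofAxis (pos : V → Fin d → ℤ) (bscale : ℕ → ℤ)
    (hstep : ∀ ⦃u v : V⦄, G.Adj u v →
      ∃ μ : Fin d, (∀ ν, ν ≠ μ → pos u ν = pos v ν) ∧ |pos v μ - pos u μ| = bscale (min (zone u) (zone v)))
    (hinj : Function.Injective pos) : LatticeDrawing G zone d (Fin d → ℤ) where
  pos := pos
  frame := AddMonoidHom.id _
  bscale := bscale
  step := by
    intro u v h
    obtain ⟨μ, hoth, habs⟩ := hstep h
    refine ⟨μ, if 0 ≤ pos v μ - pos u μ then 1 else -1, by split_ifs <;> simp, ?_⟩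
    funext ν
    simp only [AddMonoidHom.id_apply, Pi.sub_apply]
    by_cases hν : ν = μ
    · subst hν
      rw [Pi.single_eq_same]
      split_ifs with hnn
      · rw [abs_of_nonneg hnn] at habs
        rw [one_mul, habs]
      · rw [abs_of_neg (lt_of_not_ge hnn)] at habs
        linarith
    · rw [Pi.single_eq_of_ne hν, hoth ν hν, sub_self]
  inj := hinj

variable (D : LatticeDrawing G zone d A)

/-- The direction of an admissible bond. [cite: Balaban1984PropagatorsII, (2.46) p.231] -/
noncomputable def dir {u v : V} (h : G.Adj u v) : Fin d := (D.step h).choose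

/-- The orientation (±1) of an admissible bond. [cite: Balaban1984PropagatorsII, (2.46) p.231] -/
noncomputable def sgn {u v : V} (h : G.Adj u v) : ℤ := (D.step h).choose_spec.choose

/-- The defining property of the direction and orientation of a bond. [cite: Balaban1984PropagatorsII, (2.46) p.231] -/
theorem dir_sgn_spec {u v : V} (h : G.Adj u v) :
    (D.sgn h = 1 ∨ D.sgn h = -1) ∧
      D.pos v - D.pos u = D.frame (Pi.single (D.dir h) (D.sgn h * D.bscale (min (zone u) (zone v)))) :=
  (D.step h).choose_spec.choose_spec

/-- The STEP (direction, prescribed coarse/fine flag, orientation) read off an admissible bond u → v — one letter of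
the leg codes of (2.58) (*"s(y) denotes a scaled image of y on unit lattice"*). [cite: Balaban1984PropagatorsII, (2.58) p.233] -/
noncomputable def toStep {u v : V} (h : G.Adj u v) (b : Bool) : Step d :=
  ⟨D.dir h, b, decide (D.sgn h = -1)⟩

/-- The flag of the step read off a bond is the prescribed one. [folklore] -/
private theorem toStep_fine {u v : V} (h : G.Adj u v) (b : Bool) : (D.toStep h b).fine = b := rfl

/-- The unit vector of the step read off a bond is `sgn · e_dir` — one letter of the *"scaled image … on unit lattice"*
of (2.58). [cite: Balaban1984PropagatorsII, (2.58) p.233] -/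
theorem svec_toStep {u v : V} (h : G.Adj u v) (b : Bool) :
    svec (D.toStep h b) = Pi.single (D.dir h) (D.sgn h) := by
  have hs := (D.dir_sgn_spec h).1
  funext ν
  simp only [svec, toStep, Step.sign]
  by_cases hν : ν = D.dir h
  · rw [if_pos hν, hν, Pi.single_eq_same]
    rcases hs with h1 | h1 <;> simp [h1]
  · rw [if_neg hν, Pi.single_eq_of_ne hν]

/-- **One admissible bond displaces the position by the frame image of `bscale (min zone)` times the unit vector of its
step.** [cite: Balaban1984PropagatorsII, (2.46) p.231] -/
theorem pos_sub_eq_frame_svec {u v : V} (h : G.Adj u v) (b : Bool) :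
    D.pos v - D.pos u = D.frame (D.bscale (min (zone u) (zone v)) • svec (D.toStep h b)) := by
  rw [(D.dir_sgn_spec h).2, svec_toStep]
  congr 1
  funext ν
  simp only [Pi.smul_apply, smul_eq_mul]
  by_cases hν : ν = D.dir h
  · rw [hν, Pi.single_eq_same, Pi.single_eq_same, mul_comm]
  · rw [Pi.single_eq_of_ne hν, Pi.single_eq_of_ne hν, mul_zero]

variable [NeZero d]

/-- The step of the i-th bond of a contour, with a prescribed flag (junk past the end of the contour). [cite: Balaban1984PropagatorsII, (2.58) p.233] -/
noncomputable def stepAt {x x' : V} (p : G.Walk x x') (flag : ℕ → Bool) (i : ℕ) : Step d :=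
  if h : i < p.length then D.toStep (p.adj_getVert_succ h) (flag i) else ⟨0, false, false⟩

/-- The LEG CODE of the portion v_s … v_t of a contour: the list of the steps of its bonds.
[cite: Balaban1984PropagatorsII, (2.58) p.233] -/
noncomputable def steps {x x' : V} (p : G.Walk x x') (flag : ℕ → Bool) (s t : ℕ) : List (Step d) :=
  (List.Ico s t).map (D.stepAt p flag)

/-- A leg code has one letter per bond. [cite: Balaban1984PropagatorsII, (2.48) p.232] -/
theorem steps_length {x x' : V} (p : G.Walk x x') (flag : ℕ → Bool) (s t : ℕ) :
    (D.steps p flag s t).length = t - s := by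
  simp [steps]

/-- The empty portion codes the empty leg. [folklore] -/
private theorem steps_self {x x' : V} (p : G.Walk x x') (flag : ℕ → Bool) (s : ℕ) : D.steps p flag s s = [] := by
  simp [steps]

/-- Extending a portion by one bond appends its step. [folklore] -/
private theorem steps_succ {x x' : V} (p : G.Walk x x') (flag : ℕ → Bool) {s t : ℕ} (hst : s ≤ t) :
    D.steps p flag s (t + 1) = D.steps p flag s t ++ [D.stepAt p flag t] := by
  simp [steps, List.Ico.succ_top hst]

end LatticeDrawing

/-- pathC of a concatenation of legs. [folklore] -/
private theorem pathC_append (l₁ l₂ : List (Step d)) : pathC (l₁ ++ l₂) = pathC l₁ + pathC l₂ := by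
  induction l₁ with
  | nil => rw [List.nil_append, pathC_nil, zero_add]
  | cons s l ih => rw [List.cons_append, pathC_cons, pathC_cons, ih, add_assoc]

/-- pathF of a concatenation of legs. [folklore] -/
private theorem pathF_append (l₁ l₂ : List (Step d)) : pathF (l₁ ++ l₂) = pathF l₁ + pathF l₂ := by
  induction l₁ with
  | nil => rw [List.nil_append, pathF_nil, zero_add]
  | cons s l ih => rw [List.cons_append, pathF_cons, pathF_cons, ih, add_assoc]

/-- pathV of a concatenation of legs. [folklore] -/
private theorem pathV_append (l₁ l₂ : List (Step d)) : pathV (l₁ ++ l₂) = pathV l₁ + pathV l₂ := by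
  unfold pathV
  rw [pathC_append, pathF_append]
  abel

/-- pathV of a one-bond leg. [folklore] -/
private theorem pathV_singleton (s : Step d) : pathV [s] = svec s := by
  rw [pathV_cons, pathV_nil, add_zero]

/-- pathC of a one-bond leg. [folklore] -/
private theorem pathC_singleton (s : Step d) : pathC [s] = s.cvec := by
  rw [pathC_cons, pathC_nil, add_zero]

/-- pathF of a one-bond leg. [folklore] -/
private theorem pathF_singleton (s : Step d) : pathF [s] = s.fvec := by
  rw [pathF_cons, pathF_nil, add_zero]

namespace LatticeDrawing

variable [NeZero d] (D : LatticeDrawing G zone d A)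

/-- **Single-scale legs: the code determines the displacement.** Along a portion v_s … v_t all of whose bonds are
Λ_q-bonds (`min zone = q`), `pos v_t − pos v_s = frame (bscale q · pathV (code))` — the portions Γ_{y,y₁} and
Γ_{y′_l,y_{l+1}} of (2.47) (p. 231: *"contained in B^{j_{l,l+1}}(Λ_{j_{l,l+1}})"*; p. 233: *"The distances … are scaled to
unit lattice"*). [cite: Balaban1984PropagatorsII, (2.47) p.231, (2.58) p.233] -/
theorem pos_sub_single {x x' : V} (p : G.Walk x x') (flag : ℕ → Bool) {s t : ℕ} (hst : s ≤ t)
    (htn : t ≤ p.length) {q : ℕ}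
    (hq : ∀ i, s ≤ i → i < t → min (zone (p.getVert i)) (zone (p.getVert (i + 1))) = q) :
    D.pos (p.getVert t) - D.pos (p.getVert s) = D.frame (D.bscale q • pathV (D.steps p flag s t)) := by
  induction t, hst using Nat.le_induction with
  | base => rw [D.steps_self, pathV_nil, smul_zero, map_zero, sub_self]
  | succ t hst ih =>
    have ih' := ih (by omega) (fun i h1 h2 => hq i h1 (by omega))
    have hlt : t < p.length := by omega
    have hone := D.pos_sub_eq_frame_svec (p.adj_getVert_succ hlt) (flag t)
    rw [hq t hst (Nat.lt_succ_self t)] at hone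
    have hstep : D.stepAt p flag t = D.toStep (p.adj_getVert_succ hlt) (flag t) := by
      simp [stepAt, hlt]
    have htel : D.pos (p.getVert (t + 1)) - D.pos (p.getVert s) =
        (D.pos (p.getVert (t + 1)) - D.pos (p.getVert t)) + (D.pos (p.getVert t) - D.pos (p.getVert s)) := by abel
    rw [D.steps_succ p flag hst, pathV_append, pathV_singleton, smul_add, map_add, htel, ih', hstep, hone]
    abel

/-- **Two-scale legs: the coarse and fine codes determine the displacement.** Along a portion v_s … v_t all of whose
bonds are Λ_q- or Λ_{q−1}-bonds (`min zone ∈ {q − 1, q}`), flagging the Λ_{q−1}-bonds as fine,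
`pos v_t − pos v_s = frame (bscale q · pathC (code) + bscale (q−1) · pathF (code))` — the portions Γ_{y_l,y′_l} of (2.47)
(p. 231: contained in B^{j_l}(Λ_{j_l}) ∪ B^{j_l−1}(Λ_{j_l−1})). [cite: Balaban1984PropagatorsII, (2.47) p.231, (2.58) p.233] -/
theorem pos_sub_two {x x' : V} (p : G.Walk x x') {s t : ℕ} (hst : s ≤ t) (htn : t ≤ p.length) {q : ℕ}
    (hq : ∀ i, s ≤ i → i < t → min (zone (p.getVert i)) (zone (p.getVert (i + 1))) = q ∨
      min (zone (p.getVert i)) (zone (p.getVert (i + 1))) + 1 = q) :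
    D.pos (p.getVert t) - D.pos (p.getVert s) =
      D.frame (D.bscale q •
          pathC (D.steps p (fun i => decide (min (zone (p.getVert i)) (zone (p.getVert (i + 1))) < q)) s t)
        + D.bscale (q - 1) •
          pathF (D.steps p (fun i => decide (min (zone (p.getVert i)) (zone (p.getVert (i + 1))) < q)) s t)) := by
  set flag : ℕ → Bool := fun i => decide (min (zone (p.getVert i)) (zone (p.getVert (i + 1))) < q) with hflag
  induction t, hst using Nat.le_induction with
  | base => rw [D.steps_self, pathC_nil, pathF_nil, smul_zero, smul_zero, add_zero, map_zero, sub_self]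
  | succ t hst ih =>
    have ih' := ih (by omega) (fun i h1 h2 => hq i h1 (by omega))
    have hlt : t < p.length := by omega
    have hone := D.pos_sub_eq_frame_svec (p.adj_getVert_succ hlt) (flag t)
    have hstep : D.stepAt p flag t = D.toStep (p.adj_getVert_succ hlt) (flag t) := by
      simp [stepAt, hlt]
    have htel : D.pos (p.getVert (t + 1)) - D.pos (p.getVert s) =
        (D.pos (p.getVert (t + 1)) - D.pos (p.getVert t)) + (D.pos (p.getVert t) - D.pos (p.getVert s)) := by abel
    rw [D.steps_succ p flag hst, pathC_append, pathF_append, pathC_singleton, pathF_singleton, smul_add, smul_add,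
      htel, ih', hstep]
    rcases hq t hst (Nat.lt_succ_self t) with h | h
    · -- a Λ_q-bond: coarse letter
      have hff : flag t = false := by simp only [hflag, h, lt_self_iff_false, decide_false]
      have hf' : (D.toStep (p.adj_getVert_succ hlt) (flag t)).fine = false := by rw [toStep_fine, hff]
      rw [cvec_of_fine_false _ hf', fvec_of_fine_false _ hf', smul_zero, hone, h, ← map_add]
      congr 1
      abel
    · -- a Λ_{q−1}-bond: fine letter
      have hft : flag t = true := by simp [hflag, ← h]
      have hf' : (D.toStep (p.adj_getVert_succ hlt) (flag t)).fine = true := by rw [toStep_fine, hft]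
      have hq1 : q - 1 = min (zone (p.getVert t)) (zone (p.getVert (t + 1))) := by omega
      rw [cvec_of_fine_true _ hf', fvec_of_fine_true _ hf', smul_zero, hone, hq1, ← map_add]
      congr 1
      abel

end LatticeDrawing

end Drawing

/-! ## §2 The leg codes of the decomposition (2.47) of a contour, and the RECONSTRUCTION of its points from the codes -/

section Positions

open B6Decomp247Surfaces (aIdx eIdx bIdx js X_facts S_zone js_step js_one_bounds js_m_bounds js_zero js_m_succ
  eIdx_le_bIdx bIdx_le_eIdx_succ eIdx_m_succ eIdx_le_length bIdx_le_length zone_getVert_eIdx zone_getVert_bIdx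
  eIdx_of_le bIdx_zero)

variable {V : Type*} {G : SimpleGraph V} {zone : V → ℕ} {d : ℕ} [NeZero d] {A : Type*} [AddCommGroup A]
variable (D : LatticeDrawing G zone d A) {x x' : V}

namespace LatticeDrawing

/-- The flag of the surface legs Γ_{y_l,y′_l} ⊂ B^{j_l}(Λ_{j_l}) ∪ B^{j_l−1}(Λ_{j_l−1}): a bond is FINE iff it is a
Λ_{j_l−1}-bond (`min zone < j_l`). [cite: Balaban1984PropagatorsII, (2.47) p.231] -/
def sflag (zone : V → ℕ) (p : G.Walk x x') (q : ℕ) : ℕ → Bool :=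
  fun i => decide (min (zone (p.getVert i)) (zone (p.getVert (i + 1))) < q)

/-- The code of the first portion Γ_{y,y₁} of (2.47) (single scale j). [cite: Balaban1984PropagatorsII, (2.47) p.231, (2.58) p.233] -/
noncomputable def leg0Of (p : G.Walk x x') : List (Step d) :=
  D.steps p (fun _ => false) 0 (eIdx zone p 1)

/-- The two-scale code of the surface portion Γ_{y_{l+1},y′_{l+1}} of (2.47) (episodes are indexed from 0 here, as in
`B6Lemma21Bridge.Decomp247`; print's l = ours + 1). [cite: Balaban1984PropagatorsII, (2.47) p.231, (2.58) p.233] -/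
noncomputable def legSOf (p : G.Walk x x') (l : ℕ) : List (Step d) :=
  D.steps p (sflag zone p (js zone p (l + 1))) (eIdx zone p (l + 1)) (bIdx zone p (l + 1))

/-- The code of the crossing portion Γ_{y′_{l+1},y_{l+2}} of (2.47) (single scale j_{l+1,l+2}; y_{m+1} = y′).
[cite: Balaban1984PropagatorsII, (2.47) p.231, (2.58) p.233] -/
noncomputable def legXOf (p : G.Walk x x') (l : ℕ) : List (Step d) :=
  D.steps p (fun _ => false) (bIdx zone p (l + 1)) (eIdx zone p (l + 2))

/-- **y₁ is determined by the code of Γ_{y,y₁}**: `pos y₁ − pos y = bscale j · pathV (leg0)` — every bond before the first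
surface point is a Λ_j-bond (y₁ ∈ Σ_j ∪ Σ_{j+1}, `js_one_bounds`). [cite: Balaban1984PropagatorsII, (2.47)–(2.48) pp.231–232, (2.58) p.233] -/
theorem pos_sub_first (hsep : Separates G zone) (p : G.Walk x x') :
    D.pos (p.getVert (eIdx zone p 1)) - D.pos x = D.frame (D.bscale (zone x) • pathV (D.leg0Of p)) := by
  have hX := (X_facts hsep p (l := 0) (Nat.zero_le _)).1
  have h1 := (js_one_bounds hsep p).1
  rw [bIdx_zero, js_zero] at hX
  have hq : ∀ i, 0 ≤ i → i < eIdx zone p 1 → min (zone (p.getVert i)) (zone (p.getVert (i + 1))) = zone x := by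
    intro i h0 hi
    rw [hX i h0 hi]
    exact min_eq_left h1
  have h := D.pos_sub_single p (fun _ => false) (Nat.zero_le _) (eIdx_le_length p 1) hq
  rwa [p.getVert_zero] at h

/-- **y′_l is determined by y_l, j_l and the two-scale code of Γ_{y_l,y′_l}**:
`pos y′_l − pos y_l = bscale j_l · pathC + bscale (j_l − 1) · pathF` (every point of the portion has zone j_l or j_l − 1,
`S_zone`). [cite: Balaban1984PropagatorsII, (2.47)–(2.48) pp.231–232, (2.58) p.233] -/
theorem pos_sub_surf (hsep : Separates G zone) (p : G.Walk x x') {l : ℕ} (hl1 : 1 ≤ l)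
    (hl : l ≤ B6Decomp247Surfaces.m zone p) :
    D.pos (p.getVert (bIdx zone p l)) - D.pos (p.getVert (eIdx zone p l)) =
      D.frame (D.bscale (js zone p l) • pathC (D.legSOf p (l - 1))
        + D.bscale (js zone p l - 1) • pathF (D.legSOf p (l - 1))) := by
  have hS := S_zone hsep p hl1 hl
  have hea : eIdx zone p l = aIdx zone p l := eIdx_of_le p hl1 hl
  have hq : ∀ i, eIdx zone p l ≤ i → i < bIdx zone p l →
      min (zone (p.getVert i)) (zone (p.getVert (i + 1))) = js zone p l ∨
        min (zone (p.getVert i)) (zone (p.getVert (i + 1))) + 1 = js zone p l := by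
    intro i h1 h2
    have ha := hS i (by omega) h2.le
    have hb := hS (i + 1) (by omega) (by omega)
    omega
  have h := D.pos_sub_two p (eIdx_le_bIdx p hl1 hl) (bIdx_le_length p hl) hq
  have hl' : l - 1 + 1 = l := by omega
  simp only [legSOf, hl']
  exact h

/-- **y_{l+1} is determined by y′_l, j_l, j_{l+1} and the code of Γ_{y′_l,y_{l+1}}**:
`pos y_{l+1} − pos y′_l = bscale (min j_l j_{l+1}) · pathV` (every bond of the crossing portion is a
Λ_{j_{l,l+1}}-bond, `X_facts`; for l = m this is the final portion Γ_{y′_m,y′}). [cite: Balaban1984PropagatorsII, (2.47)–(2.48) pp.231–232, (2.58) p.233] -/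
theorem pos_sub_cross (hsep : Separates G zone) (p : G.Walk x x') {l : ℕ} (hl1 : 1 ≤ l)
    (hl : l ≤ B6Decomp247Surfaces.m zone p) :
    D.pos (p.getVert (eIdx zone p (l + 1))) - D.pos (p.getVert (bIdx zone p l)) =
      D.frame (D.bscale (min (js zone p l) (js zone p (l + 1))) • pathV (D.legXOf p (l - 1))) := by
  have hX := (X_facts hsep p hl).1
  have h := D.pos_sub_single p (fun _ => false) (bIdx_le_eIdx_succ p hl) (eIdx_le_length p (l + 1)) hX
  have e1 : l - 1 + 1 = l := by omega
  have e2 : l - 1 + 2 = l + 1 := by omega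
  simp only [legXOf, e1, e2]
  exact h

/-- **THE RECONSTRUCTION BEHIND THE COUNT (2.58)** (p. 233: the sum over the intermediate points y_l, y′_l is
replaced by free sums over their scaled images — legitimate because the scaled images, i.e. the leg codes, together
with the branch signs of (j_l) DETERMINE the points; `B6Lemma21Bridge` header, G-A16-1): two admissible contours from
y whose end-points have the same zone, with the same number of episodes, the same leg codes and the same branch signs,
END AT THE SAME POINT — by induction along the episodes: y₁ (`pos_sub_first` + injectivity of the drawing), hence j₁;
then y′_l from y_l (`pos_sub_surf`), j_{l+1} = j_l ± 1 from the sign, y_{l+1} from y′_l (`pos_sub_cross`).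
[cite: Balaban1984PropagatorsII, (2.47) p.231, (2.58) p.233] -/
theorem reconstruct (hsep : Separates G zone) {x₁ x₂ : V} (p₁ : G.Walk x x₁) (p₂ : G.Walk x x₂)
    (hz : zone x₁ = zone x₂) (hM : B6Decomp247Surfaces.m zone p₁ = B6Decomp247Surfaces.m zone p₂)
    (h0 : pathV (D.leg0Of p₁) = pathV (D.leg0Of p₂))
    (hC : ∀ l, l < B6Decomp247Surfaces.m zone p₁ → pathC (D.legSOf p₁ l) = pathC (D.legSOf p₂ l))
    (hF : ∀ l, l < B6Decomp247Surfaces.m zone p₁ → pathF (D.legSOf p₁ l) = pathF (D.legSOf p₂ l))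
    (hXc : ∀ l, l < B6Decomp247Surfaces.m zone p₁ → pathV (D.legXOf p₁ l) = pathV (D.legXOf p₂ l))
    (hb : ∀ l, l + 1 < B6Decomp247Surfaces.m zone p₁ →
      ((js zone p₁ (l + 2) : ℤ) - js zone p₁ (l + 1) ≤ 0 ↔ (js zone p₂ (l + 2) : ℤ) - js zone p₂ (l + 1) ≤ 0)) :
    x₁ = x₂ := by
  have key : ∀ l, 1 ≤ l → l ≤ B6Decomp247Surfaces.m zone p₁ + 1 →
      D.pos (p₁.getVert (eIdx zone p₁ l)) = D.pos (p₂.getVert (eIdx zone p₂ l)) ∧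
        js zone p₁ l = js zone p₂ l := by
    intro l hl1 hlM
    induction l, hl1 using Nat.le_induction with
    | base =>
      have e₁ := D.pos_sub_first hsep p₁
      have e₂ := D.pos_sub_first hsep p₂
      rw [h0] at e₁
      have hpos : D.pos (p₁.getVert (eIdx zone p₁ 1)) = D.pos (p₂.getVert (eIdx zone p₂ 1)) :=
        sub_left_inj.mp (e₁.trans e₂.symm)
      refine ⟨hpos, ?_⟩
      have hv := D.inj hpos
      rw [← zone_getVert_eIdx (zone := zone) p₁ 1, ← zone_getVert_eIdx (zone := zone) p₂ 1, hv]
    | succ l hl1 ih =>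
      obtain ⟨ihpos, ihj⟩ := ih (by omega)
      have hlM₁ : l ≤ B6Decomp247Surfaces.m zone p₁ := by omega
      have hlM₂ : l ≤ B6Decomp247Surfaces.m zone p₂ := by omega
      -- the surface portion of episode l
      have s₁ := D.pos_sub_surf hsep p₁ hl1 hlM₁
      have s₂ := D.pos_sub_surf hsep p₂ hl1 hlM₂
      rw [hC (l - 1) (by omega), hF (l - 1) (by omega), ihj] at s₁
      have hposb : D.pos (p₁.getVert (bIdx zone p₁ l)) = D.pos (p₂.getVert (bIdx zone p₂ l)) := by
        have h := s₁.trans s₂.symm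
        rw [ihpos] at h
        exact sub_left_inj.mp h
      -- the index of the next surface
      have hj : js zone p₁ (l + 1) = js zone p₂ (l + 1) := by
        rcases Nat.lt_or_ge l (B6Decomp247Surfaces.m zone p₁) with hlt | hge
        · have st₁ := js_step hsep p₁ hl1 (show l + 1 ≤ B6Decomp247Surfaces.m zone p₁ by omega)
          have st₂ := js_step hsep p₂ hl1 (show l + 1 ≤ B6Decomp247Surfaces.m zone p₂ by omega)
          have hbit := hb (l - 1) (by omega)
          rw [show l - 1 + 2 = l + 1 by omega, show l - 1 + 1 = l by omega] at hbit
          rw [ihj] at st₁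
          by_cases hc : (js zone p₁ (l + 1) : ℤ) - js zone p₁ l ≤ 0
          · have hc₂ := hbit.mp hc
            omega
          · have hc₂ : ¬ ((js zone p₂ (l + 1) : ℤ) - js zone p₂ l ≤ 0) := fun h => hc (hbit.mpr h)
            omega
        · have e₁ : js zone p₁ (l + 1) = zone x₁ := by
            rw [show l = B6Decomp247Surfaces.m zone p₁ by omega]; exact js_m_succ p₁
          have e₂ : js zone p₂ (l + 1) = zone x₂ := by
            rw [show l = B6Decomp247Surfaces.m zone p₂ by omega]; exact js_m_succ p₂
          rw [e₁, e₂, hz]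
      -- the crossing portion after episode l
      have c₁ := D.pos_sub_cross hsep p₁ hl1 hlM₁
      have c₂ := D.pos_sub_cross hsep p₂ hl1 hlM₂
      rw [hXc (l - 1) (by omega), ihj, hj] at c₁
      have hpose : D.pos (p₁.getVert (eIdx zone p₁ (l + 1))) = D.pos (p₂.getVert (eIdx zone p₂ (l + 1))) := by
        have h := c₁.trans c₂.symm
        rw [hposb] at h
        exact sub_left_inj.mp h
      exact ⟨hpose, hj⟩
  obtain ⟨hfin, -⟩ := key (B6Decomp247Surfaces.m zone p₁ + 1) (by omega) le_rfl
  have h₁ : p₁.getVert (eIdx zone p₁ (B6Decomp247Surfaces.m zone p₁ + 1)) = x₁ := by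
    rw [eIdx_m_succ p₁, p₁.getVert_length]
  have h₂ : p₂.getVert (eIdx zone p₂ (B6Decomp247Surfaces.m zone p₁ + 1)) = x₂ := by
    rw [hM, eIdx_m_succ p₂, p₂.getVert_length]
  rw [h₁, h₂] at hfin
  exact D.inj hfin

/-- **THE TOTAL CODE LENGTH IS THE NUMBER OF BONDS** ((2.48), first line, read on the portions of (2.47): the
portions [0, e₁), [e_l, b_l), [b_l, e_{l+1}) tile [0, |Γ|]). [cite: Balaban1984PropagatorsII, (2.47)–(2.48) pp.231–232] -/
theorem codes_length (p : G.Walk x x') :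
    (D.leg0Of p).length + ∑ l ∈ Finset.range (B6Decomp247Surfaces.m zone p), (D.legSOf p l).length
      + ∑ l ∈ Finset.range (B6Decomp247Surfaces.m zone p), (D.legXOf p l).length = p.length := by
  have key : ∀ n, n ≤ B6Decomp247Surfaces.m zone p →
      (D.leg0Of p).length + ∑ l ∈ Finset.range n, (D.legSOf p l).length
        + ∑ l ∈ Finset.range n, (D.legXOf p l).length = eIdx zone p (n + 1) := by
    intro n hn
    induction n with
    | zero => simp [leg0Of, steps_length]
    | succ n ih =>
      have ih' := ih (by omega)
      have h1 := eIdx_le_bIdx (zone := zone) p (l := n + 1) (by omega) (by omega)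
      have h2 := bIdx_le_eIdx_succ (zone := zone) p (l := n + 1) (by omega)
      have hS : (D.legSOf p n).length = bIdx zone p (n + 1) - eIdx zone p (n + 1) := D.steps_length p _ _ _
      have hX : (D.legXOf p n).length = eIdx zone p (n + 1 + 1) - bIdx zone p (n + 1) := D.steps_length p _ _ _
      have h2' : bIdx zone p (n + 1) ≤ eIdx zone p (n + 1 + 1) := h2
      rw [Finset.sum_range_succ, Finset.sum_range_succ, hS, hX]
      omega
  rw [key _ le_rfl, eIdx_m_succ]

end LatticeDrawing

end Positions

/-! ## §3 `Decomp247` CONSTRUCTED for every lattice-drawn contour system; (2.61″) and Lemma 2.1 with the d-only constant -/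

section Assembly

open B6Decomp247Surfaces (js js_step js_one_bounds js_m_bounds js_zero js_m_succ X_facts)
open B6Decomp247LevelGap (length_ge_mul_episodes)

variable {g : B6.Geometry} {C : ContourSystem g} {d : ℕ} [NeZero d] {A : Type*} [AddCommGroup A]

/-- A SHORTEST admissible contour between two sites (p. 231: *"Of course the infimum is attained at some contour
Γ_{y,y′}"*). [cite: Balaban1984PropagatorsII, (2.46) p.231] -/
noncomputable def spath (hconn : C.bond.Connected) (y y' : g.Site) : C.bond.Walk (C.ι y) (C.ι y') :=
  (hconn.exists_walk_length_eq_dist (C.ι y) (C.ι y')).choose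

/-- The chosen contour is shortest. [cite: Balaban1984PropagatorsII, (2.46) p.231] -/
theorem spath_length (hconn : C.bond.Connected) (y y' : g.Site) :
    (spath hconn y y').length = C.bond.dist (C.ι y) (C.ι y') :=
  (hconn.exists_walk_length_eq_dist (C.ι y) (C.ι y')).choose_spec

/-- For a realised geometry d(y, y′) IS the number of bonds of the chosen shortest contour. [cite: Balaban1984PropagatorsII, (2.46) p.231] -/
theorem dist_eq_spath_length (hreal : Realizes g C) (hconn : C.bond.Connected) (y y' : g.Site) :
    g.dist y y' = ((spath hconn y y').length : ℝ) := by
  rw [hreal y y', dist246, spath_length]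

/-- **THE DECOMPOSITION DATA (2.47)/(2.48)/(2.57) OF `B6Lemma21Bridge` — CONSTRUCTED, for every base point, on every
contour system DRAWN ON A LATTICE** (realising the geometry, connected, with the surfaces separating and the walk form
`LevelGap N` of (2.2), `RM ≤ N`): per end-point y′ the printed decomposition of a SHORTEST admissible contour Γ_{y,y′}
(`B6Decomp247Surfaces`: m, j_l, y_l, y′_l) with its three kinds of portions CODED by their signed axis steps — `hstep`
= |j_l − j_{l+1}| = 1 (`js_step`), `hfirst` = y₁ ∈ Σ_j ∪ Σ_{j+1} (`js_one_bounds`), `hlast` = the last surface is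
Σ_{j′} or Σ_{j′+1} (`js_m_bounds`), `hzero`, `hsep` = RM(m − 1) ≤ d(y, y′) ((2.57), `length_ge_mul_episodes`), `hwt` =
the codes have d(y, y′) letters ((2.48)), `hinj` = THE RECONSTRUCTION (`reconstruct`).  This discharges the existence
leaf *"WHAT REMAINS"* of `B6Lemma21Bridge` (census hypothesis H-B6.1) at the generality of the dictionary.
[cite: Balaban1984PropagatorsII, (2.47)–(2.48) pp.231–232, (2.57)–(2.58) p.233] -/
noncomputable def decomp247 (D : LatticeDrawing C.bond C.zone d A) (hreal : Realizes g C) (hconn : C.bond.Connected)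
    (hsep : Separates C.bond C.zone) {N : ℕ} (hgap : LevelGap C.bond C.zone N) (hRM : g.R * g.M ≤ N)
    (hι : Function.Injective C.ι) (y : g.Site) : Decomp247 g d y where
  m y' := B6Decomp247Surfaces.m C.zone (spath hconn y y')
  js y' l := (js C.zone (spath hconn y y') (l + 1) : ℤ)
  leg0 y' := D.leg0Of (spath hconn y y')
  legS y' l := D.legSOf (spath hconn y y') l
  legX y' l := D.legXOf (spath hconn y y') l
  hstep y' l hl := by
    have h := js_step hsep (spath hconn y y') (l := l + 1) (by omega) (by omega)
    rw [abs_le]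
    constructor <;> omega
  hfirst y' hm := by
    have h := js_one_bounds hsep (spath hconn y y')
    rw [C.zone_ι] at h
    change |((js C.zone (spath hconn y y') 1 : ℕ) : ℤ) - (g.scale y : ℤ)| ≤ 1
    rw [abs_le]
    constructor <;> omega
  hlast y' hm := by
    have h := js_m_bounds hsep (spath hconn y y')
    rw [C.zone_ι] at h
    have e : B6Decomp247Surfaces.m C.zone (spath hconn y y') - 1 + 1 = B6Decomp247Surfaces.m C.zone (spath hconn y y') := by omega
    rw [e, abs_le]
    constructor <;> omega
  hzero y' hm := by
    have hX := (X_facts hsep (spath hconn y y') (l := 0) (Nat.zero_le _)).2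
    have e : js C.zone (spath hconn y y') 1 = g.scale y' := by
      rw [← C.zone_ι y', ← js_m_succ (zone := C.zone) (spath hconn y y'), hm]
    rw [js_zero, C.zone_ι, e] at hX
    rw [abs_le]
    constructor <;> omega
  hsep y' := by
    have h := length_ge_mul_episodes hsep hgap (spath hconn y y')
    rw [dist_eq_spath_length hreal hconn]
    calc g.R * g.M * ((B6Decomp247Surfaces.m C.zone (spath hconn y y') - 1 : ℕ) : ℝ)
        ≤ (N : ℝ) * ((B6Decomp247Surfaces.m C.zone (spath hconn y y') - 1 : ℕ) : ℝ) :=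
          mul_le_mul_of_nonneg_right hRM (Nat.cast_nonneg _)
      _ = ((N * (B6Decomp247Surfaces.m C.zone (spath hconn y y') - 1) : ℕ) : ℝ) := by push_cast; ring
      _ ≤ ((spath hconn y y').length : ℝ) := by exact_mod_cast h
  hwt y' := by
    rw [dist_eq_spath_length hreal hconn, D.codes_length]
  hinj y₁ y₂ hsc hm h0 hC hF hX hb := by
    apply hι
    exact D.reconstruct hsep (spath hconn y y₁) (spath hconn y y₂) (by rw [C.zone_ι, C.zone_ι, hsc]) hm h0 hC hF hX hb

/-- **(2.61″) WITH THE d-ONLY CONSTANT c₁″ = 13c₀(½α)^{4d} FOR EVERY LATTICE-DRAWN CONTOUR SYSTEM**: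
`sup_y Σ_{y′} e^{−αδ₀d(y,y′)} ≤ c₁″` under (2.59), for every geometry realised by a connected contour system drawn on a
lattice with separating surfaces and the walk form of (2.2) (`LevelGap N`, RM ≤ N) — `B6Lemma21Bridge.ineq261T_of_decomp`
fed with the constructed data. The constant depends on d, δ₀, α only (not on L, k, M, R, the domains).
The printed c₁(α) = 12c₀(½α)^d stays refuted as typed (`B6Lemma21Counterexample`, G-A11-1/G-A13-1/G-A16-1).
[cite: Balaban1984PropagatorsII, Lemma 2.1 (2.61) p.234, (2.54)–(2.59) p.233; corrected] -/
theorem ineq261T_of_latticeDrawing (D : LatticeDrawing C.bond C.zone d A) (hreal : Realizes g C)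
    (hconn : C.bond.Connected) (hsep : Separates C.bond C.zone) {N : ℕ} (hgap : LevelGap C.bond C.zone N)
    (hRM : g.R * g.M ≤ N) (hι : Function.Injective C.ι) {δ₀ α : ℝ} (hα : 0 < α) (hδ : 0 < δ₀)
    (h259 : B6.Cond259 d δ₀ α g.R g.M) :
    B6Lemma21Repaired.Ineq261With (B6Lemma21TwoScale.c1TwoScale d δ₀ α) g δ₀ α :=
  B6Lemma21Bridge.ineq261T_of_decomp hα hδ h259 (decomp247 D hreal hconn hsep hgap hRM hι)

/-- **THE ROW SUM AS A NUMBER**: `Σ_{y′∈𝔅} e^{−αδ₀d(y,y′)} ≤ 13c₀(½α)^{4d}` for every base point.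
[cite: Balaban1984PropagatorsII, (2.61) p.234; corrected] -/
theorem sum_exp_le_of_latticeDrawing (D : LatticeDrawing C.bond C.zone d A) (hreal : Realizes g C)
    (hconn : C.bond.Connected) (hsep : Separates C.bond C.zone) {N : ℕ} (hgap : LevelGap C.bond C.zone N)
    (hRM : g.R * g.M ≤ N) (hι : Function.Injective C.ι) {δ₀ α : ℝ} (hα : 0 < α) (hδ : 0 < δ₀)
    (h259 : B6.Cond259 d δ₀ α g.R g.M) (y : g.Site) :
    ∑ y' : g.Site, Real.exp (-(α * δ₀ * g.dist y y')) ≤ 13 * B6.c0 δ₀ (α / 2) ^ (4 * d) :=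
  ineq261T_of_latticeDrawing D hreal hconn hsep hgap hRM hι hα hδ h259 y

variable {I : Type}

/-- **LEMMA 2.1 WITH THE d-ONLY TWO-SCALE CONSTANT FOR EVERY FAMILY OF LATTICE-DRAWN GEOMETRIES**:
`B6Lemma21TwoScale.Lemma21TwoScale d δ₀ geo` — (2.60) ∧ (2.61″) under print's hypotheses 0 < α < 1 and (2.59) —
with NO decomposition hypothesis left (`B6Lemma21Bridge.lemma21TwoScale_of_decomp`, its `hdecomp` discharged by
`decomp247`). [cite: Balaban1984PropagatorsII, Lemma 2.1 (2.60)–(2.61) p.234; corrected] -/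
theorem lemma21TwoScale_of_latticeDrawing (d : ℕ) [NeZero d] (δ₀ : ℝ) (hδ : 0 < δ₀) (geo : I → B6.Geometry)
    (C : ∀ i, ContourSystem (geo i)) (N : I → ℕ) (A : I → Type*) [∀ i, AddCommGroup (A i)]
    (D : ∀ i, LatticeDrawing (C i).bond (C i).zone d (A i))
    (hreal : ∀ i, Realizes (geo i) (C i)) (hconn : ∀ i, (C i).bond.Connected)
    (hsep : ∀ i, Separates (C i).bond (C i).zone) (hgap : ∀ i, LevelGap (C i).bond (C i).zone (N i))
    (hRM : ∀ i, (geo i).R * (geo i).M ≤ N i) (hι : ∀ i, Function.Injective (C i).ι) :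
    B6Lemma21TwoScale.Lemma21TwoScale d δ₀ geo :=
  B6Lemma21Bridge.lemma21TwoScale_of_decomp d δ₀ hδ geo C N hreal hconn hgap hRM
    (fun i _ y => decomp247 (D i) (hreal i) (hconn i) (hsep i) (hgap i) (hRM i) (hι i) y)

/-- **ALL FOUR DISPLAYS (2.60)–(2.63) OF LEMMA 2.1 WITH c₁″** for every family of lattice-drawn geometries, under
0 < α < 1 and (2.59) ((2.54) is a theorem of realised geometries, `B6Geometry.triangle254_of_realizes`).
[cite: Balaban1984PropagatorsII, Lemma 2.1 (2.60)–(2.63) p.234; corrected] -/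
theorem lemma21_full_of_latticeDrawing (d : ℕ) [NeZero d] (δ₀ : ℝ) (hδ : 0 < δ₀) (geo : I → B6.Geometry)
    (C : ∀ i, ContourSystem (geo i)) (N : I → ℕ) (A : I → Type*) [∀ i, AddCommGroup (A i)]
    (D : ∀ i, LatticeDrawing (C i).bond (C i).zone d (A i))
    (hreal : ∀ i, Realizes (geo i) (C i)) (hconn : ∀ i, (C i).bond.Connected)
    (hsep : ∀ i, Separates (C i).bond (C i).zone) (hgap : ∀ i, LevelGap (C i).bond (C i).zone (N i))
    (hRM : ∀ i, (geo i).R * (geo i).M ≤ N i) (hι : ∀ i, Function.Injective (C i).ι) :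
    ∀ i : I, (geo i).Hyp21_22 → ∀ α : ℝ, 0 < α → α < 1 → B6.Cond259 d δ₀ α (geo i).R (geo i).M →
      B6RandomWalk.Ineq260 (geo i) δ₀ α ∧
        B6Lemma21Repaired.Ineq261With (B6Lemma21TwoScale.c1TwoScale d δ₀ α) (geo i) δ₀ α ∧
        B6Lemma21Repaired.Ineq262With (B6Lemma21TwoScale.c1TwoScale d δ₀ α) (geo i) δ₀ α ∧
        B6Lemma21Repaired.Ineq263With (B6Lemma21TwoScale.c1TwoScale d δ₀ α) (geo i) δ₀ α :=
  B6Lemma21TwoScale.lemma21TwoScale_full d δ₀ hδ.le geo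
    (fun i => B6Geometry.triangle254_of_realizes (hreal i) (hconn i))
    (lemma21TwoScale_of_latticeDrawing d δ₀ hδ geo C N A D hreal hconn hsep hgap hRM hι)

end Assembly

/-! ## §4 The (k+1)-level tower is a lattice drawing: (2.61″) on every tower RE-DERIVED by the general route -/

section Tower

open B6LevelTower

variable (d : ℕ) [NeZero d] (k a mm L : ℕ) (η R : ℝ)

/-- On the tower the x₀-coordinate of the position separates the levels (L ≥ 1): a level-j point has
`off_j ≤ pos₀ ≤ off_j + aL^j < off_{j+1}`. [cite: Balaban1984PropagatorsII, (2.1)–(2.3) p.224] -/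
theorem tower_lvl_eq_of_pos_eq {L : ℕ} (hL : 1 ≤ L) {y y' : TW d k a}
    (h : B6LevelTower.pos L y = B6LevelTower.pos L y') : lvl y = lvl y' := by
  have key : ∀ {u v : TW d k a}, B6LevelTower.pos L u 0 = B6LevelTower.pos L v 0 → ¬ lvl u < lvl v := by
    intro u v huv hlt
    have h1 := pos_zero_le L u
    have h2 := off_le_pos_zero L v
    have h3 : off L a (lvl u + 1) ≤ off L a (lvl v) := off_mono L a (by omega)
    rw [off_succ] at h3
    have hLpow : (0 : ℤ) < (L : ℤ) ^ lvl u := pow_pos (by exact_mod_cast (show 0 < L by omega)) _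
    nlinarith
  have h0 : B6LevelTower.pos L y 0 = B6LevelTower.pos L y' 0 := congr_fun h 0
  rcases Nat.lt_trichotomy (lvl y) (lvl y') with hlt | heq | hgt
  · exact absurd hlt (key h0)
  · exact heq
  · exact absurd hgt (key h0.symm)

/-- **The positions of the tower are injective** (L ≥ 1; same level: `B6TowerDecomp.eq_of_pos_eq`).
[cite: Balaban1984PropagatorsII, (2.58) p.233] -/
theorem tower_pos_injective {L : ℕ} (hL : 1 ≤ L) :
    Function.Injective (B6LevelTower.pos (d := d) (k := k) (a := a) L) :=
  fun _ _ h => B6TowerDecomp.eq_of_pos_eq hL (tower_lvl_eq_of_pos_eq d k a hL h) h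

/-- **THE TOWER IS DRAWN ON A LATTICE**: positions `B6LevelTower.pos`, a Λ_q-bond has length L^q
(`B6LevelTower.pos_step`). [cite: Balaban1984PropagatorsII, (2.46) p.231] -/
noncomputable def towerDrawing (hL : 1 ≤ L) :
    LatticeDrawing (twCS d k a mm L η R).bond (twCS d k a mm L η R).zone d (Fin d → ℤ) :=
  LatticeDrawing.ofAxis (B6LevelTower.pos L) (fun q => (L : ℤ) ^ q)
    (by
      intro u v h
      obtain ⟨μ, h1, h2⟩ := pos_step h
      exact ⟨μ, h1, by rw [abs_sub_comm]; exact h2⟩)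
    (tower_pos_injective d k a hL)

/-- **(2.61″) ON EVERY TOWER BY THE GENERAL ROUTE** (L ≥ 1, RM ≤ a + 1, (2.59); no `1 ≤ a` needed): the conclusion of
`B6TowerDecomp.twGeo_ineq261T`, re-derived through `decomp247` — cross-check of the general construction against the
tower's own encoder/decoder. [cite: Balaban1984PropagatorsII, Lemma 2.1 (2.61) p.234; corrected] -/
theorem twGeo_ineq261T_of_latticeDrawing {L : ℕ} (hL : 1 ≤ L) (hRM : R * (mm : ℝ) ≤ (a : ℝ) + 1)
    {δ₀ α : ℝ} (hα : 0 < α) (hδ : 0 < δ₀) (h259 : B6.Cond259 d δ₀ α R mm) :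
    B6Lemma21Repaired.Ineq261With (B6Lemma21TwoScale.c1TwoScale d δ₀ α) (twGeo d k a mm L η R) δ₀ α :=
  ineq261T_of_latticeDrawing (towerDrawing d k a mm L η R hL) (twGeo_realizes d k a mm L η R)
    (twCS_connected d k a mm L η R) (twCS_separates d k a mm L η R) (twCS_levelGap d k a mm L η R hL)
    (by push_cast; exact hRM) (fun _ _ h => h) hα hδ h259

/-- **Lemma 2.1 (two-scale constant) on every family of towers by the general route** (L ≥ 1, RM ≤ a + 1).
[cite: Balaban1984PropagatorsII, Lemma 2.1 (2.60)–(2.61) p.234; corrected] -/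
theorem lemma21TwoScale_towers_of_latticeDrawing {I : Type} (kk aa MM LL : I → ℕ) (ηη RR : I → ℝ)
    (hL : ∀ i, 1 ≤ LL i) (hRM : ∀ i, RR i * (MM i : ℝ) ≤ (aa i : ℝ) + 1) {δ₀ : ℝ} (hδ : 0 < δ₀) :
    B6Lemma21TwoScale.Lemma21TwoScale d δ₀ (fun i => twGeo d (kk i) (aa i) (MM i) (LL i) (ηη i) (RR i)) :=
  lemma21TwoScale_of_latticeDrawing d δ₀ hδ _ (fun i => twCS d (kk i) (aa i) (MM i) (LL i) (ηη i) (RR i))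
    (fun i => aa i + 1) (fun _ => Fin d → ℤ) (fun i => towerDrawing d (kk i) (aa i) (MM i) (LL i) (ηη i) (RR i) (hL i))
    (fun i => twGeo_realizes d (kk i) (aa i) (MM i) (LL i) (ηη i) (RR i))
    (fun i => twCS_connected d (kk i) (aa i) (MM i) (LL i) (ηη i) (RR i))
    (fun i => twCS_separates d (kk i) (aa i) (MM i) (LL i) (ηη i) (RR i))
    (fun i => twCS_levelGap d (kk i) (aa i) (MM i) (LL i) (ηη i) (RR i) (hL i))
    (fun i => by push_cast; exact hRM i) (fun _ _ _ h => h)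

end Tower

end Literature.MathematicalPhysics.QuantumFieldTheory.Balaban1983to89.B6Decomp247Lattice
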